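import Summits.Ventures.GridStability.Bench.WSCC9KBox
import Summits.Ventures.GridStability.Bench.WSCC9Deg4ASosgramDinstRoaModel
import Summits.Ventures.GridStability.Models.WSCC9FaultOnTube
import Summits.Ventures.GridStability.Bench.WSCC9CctLowerGlue
import HarnessLib

/-!
# «K(1/12) ⊂ S_deg4» — the clearing-state box at `t_cl = 1/12 s` lies inside the certified deg-4 sublevel piece of the
# WSCC9 D-instance (kernel interval arithmetic), and the ROA sentence from that box

Venture GRIDFUSION, LINE «G1cct-WSCC9-THRESH-K» / row «G1cct-WSCC9-LOWER-K» (lead g4 2026-08-27T07:24:26Z (2), 07:35:02Z (i)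
point form first, 07:45:26Z (b) «THE K OF RECORD … = the clearing-state box generated by THESE tubeLo/tubeHi at T = 1/12
from the printed pre-fault point box»); seat gridfusion-sos-3 (g4). Companion of
`Bench/WSCC9Deg4ASosgramDinst{…,Roa,RoaModel}.lean` (the D-type deg-4 certificate of the instance of record
«WSCC9-postB-SPdamp-h12», certnum-sdp-3 A′ 9d83c75afa575de8 of sos-3's claim 741461ba; `V` = `deg4_A_sosgram_Dinst_V_poly`,
253 monomials, level `c = 1159/1000`), of model-1's fault-on tube `Models/WSCC9FaultOnTube.lean` (p510936:
`WSCC9.faultBus7_tube`, `tubeLo = (131/500, 11797/250, 5997/250)`, `tubeHi = (223/250, 48009/1000, 29611/1000)` rad/s²) and of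
the K-box machinery `Bench/WSCC9KBox.lean`.

* `deg4_A_sosgram_Dinst_Vz_le_of_kbox` / `deg4_A_sosgram_Dinst_roa_of_kbox` — for ANY K-box passing
  `KBox.checkLe · deg4_A_sosgram_Dinst_V_poly (1159/1000)`: `V(Z δs x) ≤ c` on the box, and (composition with
  `deg4_A_sosgram_Dinst_model_roa`, p509956, at `γ = c`, `δs = postB_SPdamp.angleOf`) every solution of the post-fault
  model starting in the box keeps `V ≤ c`, never reaches a relative angle deviation `±π`, and returns to the equilibrium.
* `K112` — the clearing-state box at `t_cl = 1/12 s` computed EXACTLY (rational arithmetic in the kernel) from the tube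
  literals and the printed windows `a2Window = [7617/25000, 15239/50000]`, `a3Window = [761/4000, 3807/20000]`, `ω(0) = 0`:
  `a₂ ∈ a2Window + [lo₂ − hi₁, hi₂ − lo₁]/288 = [46543/100000, 3388091/7200000]`,
  `a₃ ∈ a3Window + [lo₃ − hi₁, hi₃ − lo₁]/288 = [1217/4500, 46761/160000]`, `v_j ∈ [tubeLo_j, tubeHi_j]/12 − ω∞′`
  (≈ a₂ ∈ [0.46543, 0.47057], a₃ ∈ [0.27044, 0.29226], v ∈ [−5.93369, −5.88118] × [−2.02319, −1.95477] × [−3.95652, −3.48793];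
  `ω∞′ = WSCC9.omegaInf`).
* `K112_checkLe` — THE KERNEL FACT (one `decide +kernel`, ≈ 7 s on the farm): the right endpoint of the natural interval
  extension of `V` over `zbox K112` is `≤ 1159/1000` (exact value ≈ 1.052896, margin ≈ 0.106; recast box ≈
  σ₂ ∈ [−0.21187, −0.20667], κ₂ ∈ [0.021566, 0.022786], σ₃ ∈ [−0.15320, −0.13160], κ₃ ∈ [0.008695, 0.011809]).
* `K112_mem_of_tube` — the tube's conclusion shape at `t = T = 1/12` (angle increments `Δ_i ∈ [tubeLo_i, tubeHi_i]·(1/12)²/2`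
  from pre-fault angles whose relative angles lie in the windows; printed-frame speeds `x.2 j + ω∞′ ∈ [tubeLo_j, tubeHi_j]/12`)
  ⇒ `x ∈ K112`.
* `deg4_A_sosgram_Dinst_K112_roa` — «clearing state in `K(1/12)` ⇒ `V ≤ 1159/1000` for all `t ≥ 0`, no pole slip, return to
  the post-fault equilibrium» for every solution of `postB_SPdamp.toModel` on `[0, ∞)` starting in `K112`.

THREE COLUMNS. CERTIFIED: the kernel facts above (rational interval arithmetic + the D-instance identities consumed by the
-roa files). VALIDATED (not here): model-4's independent exact evaluation on ITS narrower box bc6ee8ec5ef5d605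
(`sup V ≤ 1.0027`, 8 × 8 split; 1.079 by the natural extension), RK4 clearing state inside; HOME bench/G1-LOG.md. MODELLED: the
classical WSCC9 model M′ (`Models/WSCC9.lean`, `WSCC9FaultOn.lean`, `WSCC9FaultOnTube.lean`; MV-2 + MV-P + MV-SPD + MV-ω +
MV-h12; bolted fault at bus 7 cleared by opening line 5–7; printed pre-fault point at synchronous speed). The fault-on half
(tube ⇒ clearing state in `K112`, frame map `v = ω − ω∞′`) and the sentence «clearing AT t_cl = 1/12 s returns» are model-1's
glue on `WSCC9.faultBus7_tube` + `K112_mem_of_tube` + `deg4_A_sosgram_Dinst_K112_roa`; honest framing per RULING 27 (B): a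
kernel LOWER bound on the clearing time FOR M′ beside Anderson–Fouad's simulated 5-cycle clearing — never «the CCT», never
«the grid is stable». Exact Python mirror of the kernel arithmetic: HOME/cert/sos-3/kbox/kbox_mirror.py.
-/

noncomputable section

open Real Set Filter Topology
open Literature.Computation.Certificates Literature.Computation.Certificates.SOS
open Summit.Ventures.GridStability.Models Summit.Ventures.GridStability.Lyapunov

namespace Summit.Ventures.GridStability.Bench.WSCC9

/-! ### §3 The deg-4 D-instance: `V ≤ level` on a checked box, and the ROA sentence from the box -/

/-- `V_deg4(Z δs x) ≤ 1159/1000` for every `x` in a box passing the kernel test against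
`deg4_A_sosgram_Dinst_V_poly`. [folklore] -/
theorem deg4_A_sosgram_Dinst_Vz_le_of_kbox (B : KBox)
    (h : B.checkLe deg4_A_sosgram_Dinst_V_poly (1159 / 1000) = true) {δs : Fin 3 → ℝ}
    (hEq : WSCC9.postB_SPdamp.EqData δs) {x : ClassicalSwing.State 3} (hx : x ∈ B.toSet) :
    deg4_A_sosgram_Dinst_Vz (deg2_A_SPdampH12_Z δs x) ≤ deg4_A_sosgram_Dinst_level := by
  rw [deg4_A_sosgram_Dinst_Vz_eq_eval]
  have := KBox.eval_le_of_checkLe B h hEq hx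
  simpa [deg4_A_sosgram_Dinst_level] using this

/-- **ROA sentence from a checked box** (composition with `deg4_A_sosgram_Dinst_model_roa`, p509956, at `γ = c`,
`δs = postB_SPdamp.angleOf`): every solution of the post-fault model `postB_SPdamp.toModel` on `[0, ∞)` starting in the
box keeps `V ≤ 1159/1000`, has `|u_i(t)| < π` for all `t ≥ 0` (no pole slip), and `u_i → 0`, `ω_j → 0`.
MODELLED: M′ = classical WSCC9 post-fault instance «WSCC9-postB-SPdamp-h12». [folklore] -/
theorem deg4_A_sosgram_Dinst_roa_of_kbox (B : KBox)
    (h : B.checkLe deg4_A_sosgram_Dinst_V_poly (1159 / 1000) = true)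
    {c : ℝ → ClassicalSwing.State 3} (hc : WSCC9.postB_SPdamp.toModel.IsSolutionOn c (Ici 0)) (h0 : c 0 ∈ B.toSet) :
    (∀ t, 0 ≤ t → deg4_A_sosgram_Dinst_Vz (deg2_A_SPdampH12_Z WSCC9.postB_SPdamp.angleOf (c t)) ≤
        deg4_A_sosgram_Dinst_level) ∧
    (∀ i : Fin 2, ∀ t, 0 ≤ t → |RecastData.u WSCC9.postB_SPdamp.angleOf (c t) i.succ| < π) ∧
    (∀ i : Fin 2, Tendsto (fun t ↦ RecastData.u WSCC9.postB_SPdamp.angleOf (c t) i.succ) atTop (𝓝 0)) ∧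
    (∀ j : Fin 3, Tendsto (fun t ↦ (c t).2 j) atTop (𝓝 0)) := by
  have hside : B.sideOK = true := by
    simp only [KBox.checkLe, Bool.and_eq_true] at h; exact h.1
  exact deg4_A_sosgram_Dinst_model_roa WSCC9.postB_SPdamp_eqData
    (by simp only [deg4_A_sosgram_Dinst_level]; norm_num) le_rfl hc
    (deg4_A_sosgram_Dinst_Vz_le_of_kbox B h WSCC9.postB_SPdamp_eqData h0)
    (KBox.abs_u_lt_pi B hside h0)

/-! ### §4 THE INSTANCE `K(1/12)` of record (model-1's tube literals, p510936) -/

/-- `ω∞′` (`WSCC9.omegaInf`, the post-fault synchronous speed offset) — the frame shift `v = ω − ω∞′`. [folklore] -/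
def K112_vlo : Fin 3 → ℚ := ![131 / 500 / 12 - WSCC9.omegaInf, 11797 / 250 / 12 - WSCC9.omegaInf, 5997 / 250 / 12 - WSCC9.omegaInf]

/-- Upper speed corners of `K(1/12)`: `tubeHi/12 − ω∞′`. [folklore] -/
def K112_vhi : Fin 3 → ℚ := ![223 / 250 / 12 - WSCC9.omegaInf, 48009 / 1000 / 12 - WSCC9.omegaInf, 29611 / 1000 / 12 - WSCC9.omegaInf]

/-- **`K(1/12)`** — the clearing-state box at `t_cl = 1/12 s` generated by the tube literals of `WSCC9FaultOnTube.lean`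
from the printed pre-fault windows (`a2Window = [7617/25000, 15239/50000]`, `a3Window = [761/4000, 3807/20000]`,
`ω(0) = 0`): `a₂ ∈ [7617/25000 + (11797/250 − 223/250)/288, 15239/50000 + (48009/1000 − 131/500)/288]`,
`a₃ ∈ [761/4000 + (5997/250 − 223/250)/288, 3807/20000 + (29611/1000 − 131/500)/288]`, `v_j ∈ [tubeLo_j, tubeHi_j]/12 − ω∞′`. [folklore] -/
def K112 : KBox where
  a2lo := 7617 / 25000 + (11797 / 250 - 223 / 250) / 288
  a2hi := 15239 / 50000 + (48009 / 1000 - 131 / 500) / 288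
  a3lo := 761 / 4000 + (5997 / 250 - 223 / 250) / 288
  a3hi := 3807 / 20000 + (29611 / 1000 - 131 / 500) / 288
  vlo := K112_vlo
  vhi := K112_vhi

/-- **THE KERNEL FACT «K(1/12) ⊂ S_deg4»**: the natural interval extension of the 253-term `V` over the recast box of
`K(1/12)` has right endpoint `≤ 1159/1000` (exact rational arithmetic, one `decide +kernel`; the endpoint is ≈ 1.0529). [folklore] -/
theorem K112_checkLe : K112.checkLe deg4_A_sosgram_Dinst_V_poly (1159 / 1000) = true := by
  decide +kernel

/-- **Entry from the tube's conclusion shape** (model-1 `WSCC9.faultBus7_tube` at `t = T = 1/12`): a state `x` whose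
angles moved from pre-fault angles `δ0` (relative angles in the printed windows) by `Δ_i ∈ [tubeLo_i, tubeHi_i]·(1/12)²/2`
and whose printed-frame speeds `x.2 j + ω∞′` lie in `[tubeLo_j, tubeHi_j]·(1/12)` belongs to `K112`. [folklore] -/
theorem K112_mem_of_tube (x : ClassicalSwing.State 3) (δ0 : Fin 3 → ℝ)
    (ha2 : δ0 1 - δ0 0 ∈ WSCC9.a2Window) (ha3 : δ0 2 - δ0 0 ∈ WSCC9.a3Window)
    (hΔ : ∀ i : Fin 3, WSCC9.tubeLo i * (1 / 12) ^ 2 / 2 ≤ x.1 i - δ0 i ∧ x.1 i - δ0 i ≤ WSCC9.tubeHi i * (1 / 12) ^ 2 / 2)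
    (hω : ∀ i : Fin 3, WSCC9.tubeLo i * (1 / 12) ≤ x.2 i + WSCC9.omegaInf ∧ x.2 i + WSCC9.omegaInf ≤ WSCC9.tubeHi i * (1 / 12)) :
    x ∈ K112.toSet := by
  obtain ⟨ha2l, ha2u⟩ := ha2
  obtain ⟨ha3l, ha3u⟩ := ha3
  have d0 := hΔ 0; have d1 := hΔ 1; have d2 := hΔ 2
  have w0 := hω 0; have w1 := hω 1; have w2 := hω 2
  simp only [WSCC9.tubeLo, WSCC9.tubeHi, Matrix.cons_val_zero, Matrix.cons_val_one, Matrix.head_cons,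
    Matrix.cons_val_two, Matrix.tail_cons] at d0 d1 d2 w0 w1 w2
  rw [KBox.mem_toSet_iff]
  refine ⟨⟨?_, ?_⟩, ⟨?_, ?_⟩, fun j => ?_⟩
  · simp only [K112]; push_cast; linarith
  · simp only [K112]; push_cast; linarith
  · simp only [K112]; push_cast; linarith
  · simp only [K112]; push_cast; linarith
  · fin_cases j
    · change ((K112_vlo 0 : ℚ) : ℝ) ≤ x.2 0 ∧ x.2 0 ≤ ((K112_vhi 0 : ℚ) : ℝ)
      simp only [K112_vlo, K112_vhi, Matrix.cons_val_zero]; push_cast; constructor <;> linarith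
    · change ((K112_vlo 1 : ℚ) : ℝ) ≤ x.2 1 ∧ x.2 1 ≤ ((K112_vhi 1 : ℚ) : ℝ)
      simp only [K112_vlo, K112_vhi, Matrix.cons_val_one, Matrix.cons_val_zero]; push_cast; constructor <;> linarith
    · change ((K112_vlo 2 : ℚ) : ℝ) ≤ x.2 2 ∧ x.2 2 ≤ ((K112_vhi 2 : ℚ) : ℝ)
      simp only [K112_vlo, K112_vhi, Matrix.cons_val_two, Matrix.tail_cons, Matrix.head_cons]; push_cast
      constructor <;> linarith

/-- **«Clearing state in `K(1/12)` ⇒ return to synchronism, no pole slip» FOR MODEL M′** — the post-fault half of row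
«G1cct-WSCC9-LOWER-K»: every solution `c` of `postB_SPdamp.toModel` on `[0, ∞)` with `c 0 ∈ K112` keeps
`V_deg4 ≤ 1159/1000` along its recast state, satisfies `|u_i(t)| < π` for all `t ≥ 0` (no relative angle ever reaches
`±π`), and `u_i(t) → 0`, `ω_j(t) → 0` (return to the post-fault equilibrium). CERTIFIED inputs: `K112_checkLe` + the
D-instance identities (via p509641 / p509956). MODELLED: classical WSCC9, instance «WSCC9-postB-SPdamp-h12»
(MV-2 + MV-P + MV-SPD + MV-ω + MV-h12). No sentence here says a grid is stable. [folklore] -/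
theorem deg4_A_sosgram_Dinst_K112_roa {c : ℝ → ClassicalSwing.State 3}
    (hc : WSCC9.postB_SPdamp.toModel.IsSolutionOn c (Ici 0)) (h0 : c 0 ∈ K112.toSet) :
    (∀ t, 0 ≤ t → deg4_A_sosgram_Dinst_Vz (deg2_A_SPdampH12_Z WSCC9.postB_SPdamp.angleOf (c t)) ≤
        deg4_A_sosgram_Dinst_level) ∧
    (∀ i : Fin 2, ∀ t, 0 ≤ t → |RecastData.u WSCC9.postB_SPdamp.angleOf (c t) i.succ| < π) ∧
    (∀ i : Fin 2, Tendsto (fun t ↦ RecastData.u WSCC9.postB_SPdamp.angleOf (c t) i.succ) atTop (𝓝 0)) ∧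
    (∀ j : Fin 3, Tendsto (fun t ↦ (c t).2 j) atTop (𝓝 0)) :=
  deg4_A_sosgram_Dinst_roa_of_kbox K112 K112_checkLe hc h0


/-! ### §5 The named fact `hKS` of model-1's glue `Bench/WSCC9CctLowerGlue.lean` (p512035) DISCHARGED, and the row's
closed sentence (appended 2026-08-27, gridfusion-sos-3 g4; lead RULING THRESH-K 08:15:44Z (1)) -/

/-- **`hKS` discharged** — literally the hypothesis of `Bench.wscc9_clearing_5cycles_returns_of_KS` (model-1, p512035): for
every state whose relative angles lie in the exact-rational `K(1/12)` angle box of the tube literals and whose printed-frame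
speeds `x.2 j + ω∞′` lie in `[tubeLo_j, tubeHi_j]/12`, `V_deg4(Z(angleOf, x)) ≤ 1159/1000`. Proof: `x ∈ K112` and
`K112_checkLe`. [folklore] -/
theorem deg4_A_sosgram_Dinst_KS : ∀ x : ClassicalSwing.State 3,
    x.1 1 - x.1 0 ∈ Icc (7617 / 25000 + (11797 / 250 - 223 / 250) / 288 : ℝ)
      (15239 / 50000 + (48009 / 1000 - 131 / 500) / 288) →
    x.1 2 - x.1 0 ∈ Icc (761 / 4000 + (5997 / 250 - 223 / 250) / 288 : ℝ)
      (3807 / 20000 + (29611 / 1000 - 131 / 500) / 288) →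
    (∀ j : Fin 3, x.2 j + (WSCC9.omegaInf : ℝ) ∈ Icc (WSCC9.tubeLo j / 12) (WSCC9.tubeHi j / 12)) →
    deg4_A_sosgram_Dinst_Vz (deg2_A_SPdampH12_Z WSCC9.postB_SPdamp.angleOf x) ≤ 1159 / 1000 := by
  intro x ha2 ha3 hω
  have hmem : x ∈ K112.toSet := by
    obtain ⟨ha2l, ha2u⟩ := ha2
    obtain ⟨ha3l, ha3u⟩ := ha3
    have w0 := hω 0; have w1 := hω 1; have w2 := hω 2
    simp only [WSCC9.tubeLo, WSCC9.tubeHi, Matrix.cons_val_zero, Matrix.cons_val_one, Matrix.head_cons,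
      Matrix.cons_val_two, Matrix.tail_cons, mem_Icc] at w0 w1 w2
    rw [KBox.mem_toSet_iff]
    refine ⟨⟨?_, ?_⟩, ⟨?_, ?_⟩, fun j => ?_⟩
    · simp only [K112]; push_cast; linarith
    · simp only [K112]; push_cast; linarith
    · simp only [K112]; push_cast; linarith
    · simp only [K112]; push_cast; linarith
    · fin_cases j
      · change ((K112_vlo 0 : ℚ) : ℝ) ≤ x.2 0 ∧ x.2 0 ≤ ((K112_vhi 0 : ℚ) : ℝ)
        simp only [K112_vlo, K112_vhi, Matrix.cons_val_zero]; push_cast; constructor <;> linarith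
      · change ((K112_vlo 1 : ℚ) : ℝ) ≤ x.2 1 ∧ x.2 1 ≤ ((K112_vhi 1 : ℚ) : ℝ)
        simp only [K112_vlo, K112_vhi, Matrix.cons_val_one, Matrix.cons_val_zero]; push_cast; constructor <;> linarith
      · change ((K112_vlo 2 : ℚ) : ℝ) ≤ x.2 2 ∧ x.2 2 ≤ ((K112_vhi 2 : ℚ) : ℝ)
        simp only [K112_vlo, K112_vhi, Matrix.cons_val_two, Matrix.tail_cons, Matrix.head_cons]; push_cast
        constructor <;> linarith
  have h := deg4_A_sosgram_Dinst_Vz_le_of_kbox K112 K112_checkLe WSCC9.postB_SPdamp_eqData hmem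
  simpa only [deg4_A_sosgram_Dinst_level] using h

/-- **Row «G1cct-WSCC9-LOWER-K» (point form), CLOSED — `Bench.wscc9_clearing_5cycles_returns_of_KS` (model-1, p512035) with
its hypothesis `hKS` discharged by `deg4_A_sosgram_Dinst_KS`.** For every fault-on solution `Y` of `WSCC9.faultBus7Printed`
(bus 7 grounded, printed frame) on `[0, 1/12]` from the printed pre-fault point at synchronous speed (`ω(0) = 0`,
`δ₂(0) − δ₁(0) ∈ a2Window`, `δ₃(0) − δ₁(0) ∈ a3Window`), and every post-fault solution `c` of `WSCC9.postB_SPdamp.toModel`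
(line 5–7 opened) on `[0, ∞)` starting from the state cleared at `t_cl = 1/12 s` (`c 0 = (δ(1/12), ω(1/12) − ω∞′)`):
NO relative angle deviation ever reaches `±π` (no pole slip), every `u_i(t) → 0` and every speed deviation `→ 0`
(return to the post-fault equilibrium). MODELLED: classical WSCC9 M′ (MV-2 + MV-P + MV-SPD + MV-ω + MV-h12); honest framing
(RULING 27 (B)): «clearing AT 1/12 s (5 cycles) returns, FOR M′» — a kernel lower bound on the clearing time beside
Anderson–Fouad's simulated-stable 5-cycle case (VALIDATED column, printed), never «the CCT», never «the grid is stable».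
CERTIFIED inputs: tube p510936, `K112_checkLe` (this file), D-instance identities via p509641/p509956. [folklore] -/
theorem clearing_5cycles_returns
    {Y : ℝ → ClassicalSwing.State 3} (hY : WSCC9.faultBus7Printed.IsSolutionOn Y (Icc 0 (1 / 12)))
    (hω0 : (Y 0).2 = 0) (ha2 : (Y 0).1 1 - (Y 0).1 0 ∈ WSCC9.a2Window) (ha3 : (Y 0).1 2 - (Y 0).1 0 ∈ WSCC9.a3Window)
    {c : ℝ → ClassicalSwing.State 3} (hc : WSCC9.postB_SPdamp.toModel.IsSolutionOn c (Ici 0))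
    (hc0 : c 0 = ((Y (1 / 12)).1, fun j => (Y (1 / 12)).2 j - (WSCC9.omegaInf : ℝ))) :
    (∀ i : Fin 2, ∀ t, 0 ≤ t → |RecastData.u WSCC9.postB_SPdamp.angleOf (c t) i.succ| < π) ∧
    (∀ i : Fin 2, Tendsto (fun t => RecastData.u WSCC9.postB_SPdamp.angleOf (c t) i.succ) atTop (𝓝 0)) ∧
    (∀ j : Fin 3, Tendsto (fun t => (c t).2 j) atTop (𝓝 0)) :=
  Bench.wscc9_clearing_5cycles_returns_of_KS deg4_A_sosgram_Dinst_KS hY hω0 ha2 ha3 hc hc0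

end Summit.Ventures.GridStability.Bench.WSCC9

end
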